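import Mathlib
import Summits.KontsevichZagierPeriods.Zeta5Search.DenomLaw.LongProfiles17Path
import Summits.KontsevichZagierPeriods.Zeta5Search.DenomLaw.Profile16aPath
import HarnessLib

/-!
# ζ(5) search — PATH ACCOUNTING FOR EVERY SORTED PARAMETER VECTOR ON THE TEN LONGEST FIRST-PERIOD PROFILES, IN ONE STATEMENT (`N_p ≥ 16`)

Cell `pub-zeta5` (HONEST FRAMING: systematic search; no irrationality claim unless certified), TRACK «DENOM-LAW» D1 prover seat
(denom-prover-d1 g18, `HOME/denom-law/prover-d1/ATTEMPT-18.md` §2).  `FullProfile.pathAccountingFirstPeriod_long17` (this generation) extended by the three `N_p = 16`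
profiles — short blocks `{(1,2),…,(1,6)}` (`DenomLaw/Profile16aPath`: A⁗ / L5₈, below `d = 3p`), `{(1,2),(1,3),(1,4),(1,5),(2,3)}` (`DenomLaw/Profile16bPath`: LB /
Lemma-D, whole profile) and `{(1,2),(1,3),(1,4),(2,3),(2,4)}` (`DenomLaw/Profile16cPath`: LB / Lemma-D, whole profile).  The short pair blocks of a sorted vector form
a down-set for the order `(i,k) ≤ (i′,k′) ⇔ i ≤ i′ ∧ k ≤ k′`; the down-sets with at most five elements are `∅, {12}, {12,13}, {12,13,14}, {12,13,23}, {12,13,14,15},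
{12,13,14,23}, {12,…,16}, {12,13,14,15,23}, {12,13,14,23,24}`, so «at least 16 pair blocks reach `p`» reads: (`b₀−b₂−b₃` and `b₀−b₁−b₇` reach `p`) or
(`b₀−b₁−b₆` and `b₀−b₂−b₄` reach `p`) or (`b₀−b₁−b₅` and `b₀−b₃−b₄` reach `p`).  **`pathAccountingFirstPeriod_long16`: the node, binders VERBATIM, plus `p ≤ b₇`,
that disjunction, `d < 4p`, and `d < 3p` whenever `b₀ − b₁ − b₅ < p`** (the last hypothesis bites only on the open `3p ≤ d` cells of the branches `{12,…,15}` and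
`{12,…,16}`; `d < 4p` only on the full profile's corner).  Ten general-`b` profile theorems; no ray, no family.
MODEL/structure-side valuation bookkeeping of the cell's own rationals; nothing about ζ(5); no γ; records in print UNMOVED.
-/

namespace Summit.KontsevichZagierPeriods.Zeta5Search.FullProfile

open Summit.KontsevichZagierPeriods.Zeta5Search.CasoratianValuation (InPolytope shift casoratian pairFloors refund)
open Summit.KontsevichZagierPeriods.Zeta5Search.WedgeDictionary (dOf)
open Summit.KontsevichZagierPeriods.Zeta5Search.DenomLaw (cStar FirstPeriod Sorted7)
open Summit.KontsevichZagierPeriods.Zeta5Search.DenomLaw.FirstPeriodKit (sorted7_chain)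

/-- **`PathAccountingFirstPeriod`'s conclusion for EVERY sorted `b` on the profiles `N_p ≥ 16`, every direction `j`**: all seven parameters reach `p`, at
least 16 pair blocks reach `p` (the three-way disjunction of the module docstring), `d(b) < 4p`, and `d(b) < 3p` if `b₀ − b₁ − b₅ < p`. -/
theorem pathAccounting_long16 (b : ℕ → ℤ) (j p : ℕ) (hb : InPolytope b) (hs : Sorted7 b) (hbj : InPolytope (shift b j))
    (hj1 : 1 ≤ j) (hj7 : j ≤ 7) (hprime : p.Prime) (hp5 : 5 ≤ p) (hwin : (b 0 + 2 : ℤ) < (p : ℤ) ^ 2) (hfp : FirstPeriod b p)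
    (hP : (p : ℤ) ≤ b 7)
    (hor : ((p : ℤ) + b 2 + b 3 ≤ b 0 ∧ (p : ℤ) + b 1 + b 7 ≤ b 0) ∨ ((p : ℤ) + b 1 + b 6 ≤ b 0 ∧ (p : ℤ) + b 2 + b 4 ≤ b 0) ∨
      ((p : ℤ) + b 1 + b 5 ≤ b 0 ∧ (p : ℤ) + b 3 + b 4 ≤ b 0))
    (hd4 : dOf b < 4 * (p : ℤ)) (hd3 : b 0 < (p : ℤ) + b 1 + b 5 → dOf b < 3 * (p : ℤ)) (hcas : casoratian b j ≠ 0) :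
    dOf b / (p : ℤ) - pairFloors b p - min (if 2 ≤ dOf b / (p : ℤ) then (1 : ℤ) else 0) (5 - (cStar b p : ℤ))
      ≤ padicValRat p (casoratian b j) := by
  obtain ⟨h21, h32, h43, h54, h65, h76⟩ := sorted7_chain hs
  by_cases h17 : ((p : ℤ) + b 1 + b 6 ≤ b 0 ∧ (p : ℤ) + b 2 + b 3 ≤ b 0) ∨ ((p : ℤ) + b 1 + b 5 ≤ b 0 ∧ (p : ℤ) + b 2 + b 4 ≤ b 0)
  · exact pathAccounting_long17 b j p hb hs hbj hj1 hj7 hprime hp5 hwin hfp hP h17 hd4 hd3 hcas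
  · push Not at h17
    obtain ⟨h17a, h17b⟩ := h17
    rcases hor with ⟨h23, h17'⟩ | ⟨h16, h24⟩ | ⟨h15, h34⟩
    · -- short set `{12,…,16}`
      have h16 : b 0 < (p : ℤ) + b 1 + b 6 := by
        by_contra h; push Not at h; exact absurd h23 (not_le.2 (h17a h))
      exact pathAccounting_profile16a b j p hb hs hbj hj1 hj7 hprime hp5 hwin hfp hP h16 h17' h23 (hd3 (by linarith)) hcas
    · -- short set `{12,13,14,15,23}`
      have h23 : b 0 < (p : ℤ) + b 2 + b 3 := by
        by_contra h; push Not at h; exact absurd h (not_le.2 (h17a h16))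
      have h15 : b 0 < (p : ℤ) + b 1 + b 5 := by
        by_contra h; push Not at h; exact absurd h24 (not_le.2 (h17b h))
      exact pathAccounting_profile16b b j p hb hs hbj hj1 hj7 hprime hp5 hwin hfp hP h15 h23 h16 h24 hcas
    · -- short set `{12,13,14,23,24}`
      have h24 : b 0 < (p : ℤ) + b 2 + b 4 := by
        by_contra h; push Not at h; exact absurd h (not_le.2 (h17b h15))
      exact pathAccounting_profile16c b j p hb hs hbj hj1 hj7 hprime hp5 hwin hfp hP (by linarith) h24 h15 h34 hcas

/-- **THE NODE FOR EVERY SORTED `b` ON THE PROFILES `N_p ≥ 16`: `PathAccountingFirstPeriod` with its binders VERBATIM plus `p ≤ b₇`,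
((`p + b₂ + b₃ ≤ b₀ ∧ p + b₁ + b₇ ≤ b₀`) ∨ (`p + b₁ + b₆ ≤ b₀ ∧ p + b₂ + b₄ ≤ b₀`) ∨ (`p + b₁ + b₅ ≤ b₀ ∧ p + b₃ + b₄ ≤ b₀`)) — all parameters and at least sixteen
pair blocks reach `p` —, `d(b) < 4p`, and `d(b) < 3p` whenever `b₀ < p + b₁ + b₅`.** -/
theorem pathAccountingFirstPeriod_long16 :
    ∀ (b : ℕ → ℤ) (p : ℕ), InPolytope b → Sorted7 b → InPolytope (shift b 7) →
      p.Prime → 5 ≤ p → (b 0 + 2 : ℤ) < (p : ℤ) ^ 2 → FirstPeriod b p → (p : ℤ) ≤ b 7 →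
      (((p : ℤ) + b 2 + b 3 ≤ b 0 ∧ (p : ℤ) + b 1 + b 7 ≤ b 0) ∨ ((p : ℤ) + b 1 + b 6 ≤ b 0 ∧ (p : ℤ) + b 2 + b 4 ≤ b 0) ∨
        ((p : ℤ) + b 1 + b 5 ≤ b 0 ∧ (p : ℤ) + b 3 + b 4 ≤ b 0)) →
      dOf b < 4 * (p : ℤ) → (b 0 < (p : ℤ) + b 1 + b 5 → dOf b < 3 * (p : ℤ)) → casoratian b 7 ≠ 0 →
        dOf b / (p : ℤ) - pairFloors b p - min (if 2 ≤ dOf b / (p : ℤ) then (1 : ℤ) else 0) (5 - (cStar b p : ℤ))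
          ≤ padicValRat p (casoratian b 7) :=
  fun b p hb hs hb7 hprime hp5 hwin hfp hP hor hd4 hd3 hcas =>
    pathAccounting_long16 b 7 p hb hs hb7 (by norm_num) (by norm_num) hprime hp5 hwin hfp hP hor hd4 hd3 hcas

end Summit.KontsevichZagierPeriods.Zeta5Search.FullProfile
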